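import Mathlib
import HarnessLib
import Summits.NavierStokesRegularity.NavierStokesRegularity.Theorems.UnthreadedDoorToroidalPotentialSmooth

/-!
# Route UnthreadedRigidityDoor · crux `UnthreadedRigidity` (stmt-NavierStokesRegularity-27585) · LINE «jet rigidity»
# (planner ns-idea-6 g5, birth skeleton sha16 `5d320f85a8de9ffc`) — toward the potential-half of
# `stub_windowPotentialLaw`: chord integrals of the radial pull-back form on an OPEN TIME WINDOW

Seat ns-qj-p1 g3 (director-ns KEY-NS #141: `stub_windowPotentialLaw` assembly), `--supports
stmt-NavierStokesRegularity-27585 --as helper`. Open-window form (`S` open, `t ∈ S` in place of `t < 0`) of the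
two time-dependent smoothness lemmas of ns-es-p1 g4's `UnthreadedDoorToroidalPotentialSmooth` (1222, window
`(−∞, 0)`); the local differentiation-under-the-integral lemma `contDiffOn_parametric_intervalIntegral_of_isOpen`
of that file is time-free and is IMPORTED, not restated. Same proofs, `Iio 0 ↦ S`.

* `contDiffOn_pullbackForm_spaceTime_of_isOpen` — `(t, r, z) ↦ G_{t,r}(z) = ‖z‖⁻² (z × Ω(t, (r/‖z‖) z))` is
  `C^∞` on `S × ℝ × {z ≠ 0}` for `Ω` jointly smooth on `S × ℝ³`;
* `contDiffOn_chordIntegral_of_isOpen` — chord integrals `p ↦ ∫₀¹ ⟪G_{τ p, ρ p}(A p + s(B p − A p)), B p − A p⟫ ds`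
  are `C^∞` wherever `τ p ∈ S` and the chord avoids the origin.

HONEST FRAMING: calculus lemmas toward one kinematic stub of a line whose wall (`stub_shearedRigidity`) is OPEN;
nothing here bears on `UnthreadedRigidity`, the door Target, or Navier–Stokes regularity; no summit statement is
proved. Credit: construction and proofs by ns-es-p1 g4 (1222 (b)); this file only widens the time set. [folklore]
-/

noncomputable section

open Set Filter Function Metric MeasureTheory intervalIntegral
open scoped Topology RealInnerProductSpace ContDiff

set_option linter.dupNamespace false

namespace Summit.NavierStokesRegularity.NavierStokesRegularity.Theorems.PoloidalLiouville

open Literature.Analysis.FluidPDE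

section Chord

variable {P : Type*} [NormedAddCommGroup P] [NormedSpace ℝ P] [FiniteDimensional ℝ P]

/-- Joint smoothness of the radial pull-back field `(t, r, z) ↦ ‖z‖⁻² • (z × Ω(t, (r/‖z‖) z))` on
`S × ℝ × {z ≠ 0}` for a field `Ω` jointly smooth on `S × ℝ³`, `S` an open time set (open-window form of
ns-es-p1's `contDiffOn_pullbackForm_spaceTime`). [folklore] -/
theorem contDiffOn_pullbackForm_spaceTime_of_isOpen {S : Set ℝ} (hS : IsOpen S)
    {Ω : ℝ → EuclideanSpace ℝ (Fin 3) → EuclideanSpace ℝ (Fin 3)}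
    (hΩ : ContDiffOn ℝ ∞ (uncurry Ω) (S ×ˢ univ)) :
    ContDiffOn ℝ ∞
      (fun q : ℝ × ℝ × EuclideanSpace ℝ (Fin 3) =>
        (‖q.2.2‖ ^ 2)⁻¹ • cross q.2.2 (Ω q.1 ((q.2.1 / ‖q.2.2‖) • q.2.2)))
      {q | q.1 ∈ S ∧ q.2.2 ≠ 0} := by
  intro q hq
  have hz : q.2.2 ≠ 0 := hq.2
  refine ContDiffAt.contDiffWithinAt ?_
  have hn : ContDiffAt ℝ ∞ (fun q : ℝ × ℝ × EuclideanSpace ℝ (Fin 3) => ‖q.2.2‖) q :=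
    (contDiffAt_norm ℝ hz).comp q (contDiffAt_snd.comp q contDiffAt_snd)
  have hφ : ContDiffAt ℝ ∞ (fun q : ℝ × ℝ × EuclideanSpace ℝ (Fin 3) => (‖q.2.2‖ ^ 2)⁻¹) q :=
    (hn.pow 2).inv (pow_ne_zero _ (norm_ne_zero_iff.2 hz))
  have hπ : ContDiffAt ℝ ∞
      (fun q : ℝ × ℝ × EuclideanSpace ℝ (Fin 3) => (q.2.1 / ‖q.2.2‖) • q.2.2) q :=
    ((contDiffAt_fst.comp q contDiffAt_snd).div hn (norm_ne_zero_iff.2 hz)).smul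
      (contDiffAt_snd.comp q contDiffAt_snd)
  have hΩq : ContDiffAt ℝ ∞
      (fun q : ℝ × ℝ × EuclideanSpace ℝ (Fin 3) => Ω q.1 ((q.2.1 / ‖q.2.2‖) • q.2.2)) q := by
    have h1 : ContDiffAt ℝ ∞ (uncurry Ω) (q.1, (q.2.1 / ‖q.2.2‖) • q.2.2) :=
      hΩ.contDiffAt ((hS.prod isOpen_univ).mem_nhds ⟨hq.1, mem_univ _⟩)
    exact h1.comp q (contDiffAt_fst.prodMk hπ)
  exact hφ.smul ((crossCLM.contDiff.contDiffAt.comp q (contDiffAt_snd.comp q contDiffAt_snd)).clm_apply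
    hΩq)

/-- **Smoothness of chord integrals of the pull-back form.** For `Ω` jointly smooth on
`(−∞,0) × ℝ³` and smooth parameter maps `τ` (time), `ρ` (radius), `A`, `B` (chord endpoints) on a
finite-dimensional parameter space, the chord integral
`p ↦ ∫₀¹ ⟪G_{τ p, ρ p}(A p + s (B p − A p)), B p − A p⟫ ds` of `G_{t,r}(z) = ‖z‖⁻² (z × Ω(t, (r/‖z‖) z))`
is `C^∞` on every open set of parameters where `τ < 0` and the chord `[A p, B p]` avoids the origin.
[folklore] -/
theorem contDiffOn_chordIntegral_of_isOpen {S : Set ℝ} (hS : IsOpen S)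
    {Ω : ℝ → EuclideanSpace ℝ (Fin 3) → EuclideanSpace ℝ (Fin 3)}
    (hΩ : ContDiffOn ℝ ∞ (uncurry Ω) (S ×ˢ univ)) {τ ρ : P → ℝ}
    {A B : P → EuclideanSpace ℝ (Fin 3)} (hτ : ContDiff ℝ ∞ τ) (hρ : ContDiff ℝ ∞ ρ)
    (hA : ContDiff ℝ ∞ A) (hB : ContDiff ℝ ∞ B) {V : Set P} (hV : IsOpen V)
    (hVτ : ∀ p ∈ V, τ p ∈ S) (hVseg : ∀ p ∈ V, ∀ s ∈ Icc (0 : ℝ) 1, A p + s • (B p - A p) ≠ 0) :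
    ContDiffOn ℝ ∞ (fun p => ∫ s in (0 : ℝ)..1,
      ⟪(‖A p + s • (B p - A p)‖ ^ 2)⁻¹ • cross (A p + s • (B p - A p))
          (Ω (τ p) ((ρ p / ‖A p + s • (B p - A p)‖) • (A p + s • (B p - A p)))), B p - A p⟫) V := by
  -- the integrand as a function on `ℝ × P`, smooth on `U = {τ < 0, chord point ≠ 0}`
  set U : Set (ℝ × P) := {q | τ q.2 ∈ S ∧ A q.2 + q.1 • (B q.2 - A q.2) ≠ 0} with hU
  have hγ : ContDiff ℝ ∞ fun q : ℝ × P => A q.2 + q.1 • (B q.2 - A q.2) :=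
    (hA.comp contDiff_snd).add (contDiff_fst.smul ((hB.comp contDiff_snd).sub (hA.comp contDiff_snd)))
  have hUo : IsOpen U :=
    (hS.preimage (hτ.continuous.comp continuous_snd)).inter (isOpen_ne.preimage hγ.continuous)
  have hmaps : MapsTo (fun q : ℝ × P => (τ q.2, ρ q.2, A q.2 + q.1 • (B q.2 - A q.2))) U
      {q : ℝ × ℝ × EuclideanSpace ℝ (Fin 3) | q.1 ∈ S ∧ q.2.2 ≠ 0} := fun q hq => ⟨hq.1, hq.2⟩
  have hH : ContDiffOn ℝ ∞ (fun q : ℝ × P =>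
      ⟪(‖A q.2 + q.1 • (B q.2 - A q.2)‖ ^ 2)⁻¹ • cross (A q.2 + q.1 • (B q.2 - A q.2))
          (Ω (τ q.2) ((ρ q.2 / ‖A q.2 + q.1 • (B q.2 - A q.2)‖) • (A q.2 + q.1 • (B q.2 - A q.2)))),
        B q.2 - A q.2⟫) U := by
    have h1 := (contDiffOn_pullbackForm_spaceTime_of_isOpen hS hΩ).comp
      (((hτ.comp contDiff_snd).prodMk ((hρ.comp contDiff_snd).prodMk hγ)).contDiffOn) hmaps
    exact h1.inner ℝ (((hB.comp contDiff_snd).sub (hA.comp contDiff_snd)).contDiffOn)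
  have hsub : Icc (0 : ℝ) 1 ×ˢ V ⊆ U := fun q hq => ⟨hVτ q.2 hq.2, hVseg q.2 hq.2 q.1 hq.1⟩
  exact contDiffOn_parametric_intervalIntegral_of_isOpen hUo hV zero_le_one hsub hH

end Chord

end Summit.NavierStokesRegularity.NavierStokesRegularity.Theorems.PoloidalLiouville

end
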